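import Summits.QuantumFields.QCD.Theses.FemtoStepScaling
import HarnessLib

/-!
# `InfiniteVolumePackageC` — negative side: the UV tori and the gapped tori are asymptotically disjoint

Support lemmas for the refuter's vetting of the crux `FemtoStepScaling.InfiniteVolumePackageC`
(stmt-QuantumFields-17665). The crux's UV hypothesis speaks of the FIXED physical tori of side
`2⌊ℓ/(2a_k)⌋+1` (every `ℓ ≥ ℓ₀`, limit `k → ∞` at fixed `ℓ`), while its gluonic-gap hypothesis,
its gapless-edge hypothesis and the conclusion's `IsQCDAlong` / `HasLatticeMassGap` speak only of
tori of half-side `S ≥ L_k`, whose physical side `a_k (2S+1) ≥ a_k (2L_k+1)` tends to infinity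
(`reg.tendsto_L`). `uvTorus_eventually_lt_L` records that for every regularisation and every fixed
`ℓ` the UV torus is EVENTUALLY OUTSIDE the guard `reg.L k ≤ S`: no torus carries both hypotheses
cofinally in `k`, so "volume independence from clustering" has no clustering to use on the tori
where the continuum limits are given. `physicalGuard_eventually_at_uvTorus` and
`LGuard_eventually_of_physicalGuard` record that the PHYSICAL guard `ℓ₁ ≤ a_k (2S+1)` (all tori of
physical side at least `ℓ₁`) repairs the overlap — it holds at the UV tori of every side `ℓ > ℓ₁`
eventually — and still yields the summit-shaped guard `reg.L k ≤ S` eventually. [folklore]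
-/

namespace Summit.QuantumFields.QCD.Theorems.InfiniteVolumePackageC.Negative

open Filter Literature.MathematicalPhysics.QuantumFieldTheory

variable {Nf : ℕ}

/-- **The UV tori leave the gap regime.** For every regularisation `reg` and every fixed physical
side `ℓ`, eventually in `k` the half-side `⌊ℓ/(2a_k)⌋₊` of the UV torus is strictly below `L_k`
(because `a_k L_k → ∞`): the guard `reg.L k ≤ S` of the gap / edge clauses fails at the UV torus. [folklore] -/
theorem uvTorus_eventually_lt_L (reg : QCDRegularisation Nf) (ℓ : ℝ) :
    ∀ᶠ k in atTop, ⌊ℓ / (2 * reg.a k)⌋₊ < reg.L k := by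
  filter_upwards [reg.tendsto_L.eventually_gt_atTop (|ℓ| / 2)] with k hk
  have ha : 0 < reg.a k := reg.a_pos k
  have hx : ℓ / (2 * reg.a k) < reg.L k := by
    rw [div_lt_iff₀ (by positivity)]
    calc ℓ ≤ |ℓ| := le_abs_self ℓ
      _ = 2 * (|ℓ| / 2) := by ring
      _ < 2 * (reg.a k * reg.L k) := by linarith
      _ = (reg.L k : ℝ) * (2 * reg.a k) := by ring
  have hL : reg.L k ≠ 0 := by
    rintro h0
    rw [h0, Nat.cast_zero, mul_zero] at hk
    linarith [abs_nonneg ℓ]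
  exact (Nat.floor_lt' hL).2 hx

/-- The same fact in the shape of the crux's guard: eventually `¬ (reg.L k ≤ ⌊ℓ/(2a_k)⌋₊)`. [folklore] -/
theorem not_LGuard_eventually_at_uvTorus (reg : QCDRegularisation Nf) (ℓ : ℝ) :
    ∀ᶠ k in atTop, ¬ (reg.L k ≤ ⌊ℓ / (2 * reg.a k)⌋₊) := by
  filter_upwards [uvTorus_eventually_lt_L reg ℓ] with k hk
  exact not_le.2 hk

/-- **The physical guard overlaps the UV tori.** With the guard `ℓ₁ ≤ a_k (2S+1)` ("every torus of
physical side at least `ℓ₁`") in place of `reg.L k ≤ S`, the UV torus of every fixed side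
`ℓ > ℓ₁` satisfies the guard eventually in `k` (as soon as `a_k < ℓ − ℓ₁`; no sign condition on
`ℓ₁` is needed). [folklore] -/
theorem physicalGuard_eventually_at_uvTorus (reg : QCDRegularisation Nf) {ℓ₁ ℓ : ℝ}
    (hℓ : ℓ₁ < ℓ) :
    ∀ᶠ k in atTop, ℓ₁ ≤ reg.a k * (2 * (⌊ℓ / (2 * reg.a k)⌋₊ : ℝ) + 1) := by
  have hev : ∀ᶠ k in atTop, reg.a k < ℓ - ℓ₁ :=
    (tendsto_order.1 reg.tendsto_a).2 (ℓ - ℓ₁) (by linarith)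
  filter_upwards [hev] with k hk
  have ha : 0 < reg.a k := reg.a_pos k
  set x : ℝ := ℓ / (2 * reg.a k) with hxdef
  have hfloor : x < (⌊x⌋₊ : ℝ) + 1 := Nat.lt_floor_add_one x
  have hax : reg.a k * (2 * x) = ℓ := by
    rw [hxdef]; field_simp
  have key : ℓ - reg.a k < reg.a k * (2 * (⌊x⌋₊ : ℝ) + 1) := by
    have h2 : reg.a k * (2 * x) < reg.a k * (2 * ((⌊x⌋₊ : ℝ) + 1)) :=
      mul_lt_mul_of_pos_left (by linarith) ha
    nlinarith
  linarith

/-- **The physical guard still gives the summit-shaped guard.** If `ℓ₁ ≤ a_k (2S+1)` qualifies a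
torus, then eventually in `k` every torus with `reg.L k ≤ S` qualifies (since `a_k L_k → ∞`): a gap
hypothesis stated on all tori of physical side `≥ ℓ₁` implies the one stated on `S ≥ L_k`, so the
`HasLatticeMassGap`-shaped conclusions of the package are unaffected by the repair. [folklore] -/
theorem LGuard_eventually_of_physicalGuard (reg : QCDRegularisation Nf) (ℓ₁ : ℝ) :
    ∀ᶠ k in atTop, ∀ S : ℕ, reg.L k ≤ S → ℓ₁ ≤ reg.a k * (2 * (S : ℝ) + 1) := by
  filter_upwards [reg.tendsto_L.eventually_ge_atTop (ℓ₁ / 2)] with k hk S hS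
  have ha : 0 < reg.a k := reg.a_pos k
  have hS' : (reg.L k : ℝ) ≤ S := by exact_mod_cast hS
  have h1 : reg.a k * reg.L k ≤ reg.a k * S := mul_le_mul_of_nonneg_left hS' ha.le
  nlinarith

end Summit.QuantumFields.QCD.Theorems.InfiniteVolumePackageC.Negative
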